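import Summits.QuantumAdvantage.QuantumAdvantage.Theorems.CharDialWindowCounterA
import Summits.QuantumAdvantage.AdviceFreeQNC0.ConstantBellsDense

/-! # CharDialWindowCounterB — part 2/3 (mechanical split for landing of `CharDialWindowCounter`; content verbatim; scopes re-opened with their variables) -/

noncomputable section
open Finset

namespace Summit.QuantumAdvantage.AdviceFreeQNC0.WindowCounter
open Summit.QuantumAdvantage.AdviceFreeQNC0

/-! ## §C window-local strategies as register sign tables

For a strategy `y` that is `WindowLocal ℓ` (cut `g` reads bits `[g-ℓ, g+ℓ-1]`), the sign of cut `g` is EMITTED at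
time `k = g + ℓ - 1` (when its window has been read), from the register (most recent `2ℓ` bits) and the prefix count
`P = wtPrefix u k`, correcting the exponent by the ones inside the window: `wtPrefix u g = P - ones (r.take (ℓ-1))`
(and `-x ≡ 2x (mod 3)` keeps everything in `ℕ`).  The last `ℓ` cuts are emitted by the final factor `ftab`. -/

section Interface

variable {n : ℕ}

/-- number of `true`s in a register. -/
def ones (l : List Bool) : ℕ := l.count true

/-- CharDialWindowCounter helper `ones_nil` (decomp-qadv land package; see the module docstring). -/
@[simp] theorem ones_nil : ones [] = 0 := by simp [ones]

/-- CharDialWindowCounterB helper `ones_cons` (decomp-qadv land package; see the module docstring). -/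
@[simp] theorem ones_cons (b : Bool) (l : List Bool) : ones (b :: l) = b.toNat + ones l := by
  cases b <;> simp [ones, Nat.add_comm]

/-- CharDialWindowCounter helper `getD_of_take_eq` (decomp-qadv land package; see the module docstring). -/
theorem getD_of_take_eq {W j : ℕ} {r r' : List Bool} (h : r.take W = r'.take W) (hj : j < W) (d : Bool) :
    r.getD j d = r'.getD j d := by
  have := congrArg (fun l : List Bool => l.getD j d) h
  simp only [List.getD_eq_getElem?_getD, List.getElem?_take, if_pos hj] at this
  rw [List.getD_eq_getElem?_getD, List.getD_eq_getElem?_getD, this]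

/-- CharDialWindowCounter helper `regAt_succ` (decomp-qadv land package; see the module docstring). -/
theorem regAt_succ (u : Fin n → Bool) {k : ℕ} (hk : k < n) (r : List Bool) :
    regAt u (k + 1) r = u ⟨k, hk⟩ :: regAt u k r := by
  unfold regAt
  rw [List.take_add_one, List.getElem?_ofFn, dif_pos hk]
  simp

/-- CharDialWindowCounter helper `wtPrefix_step` (decomp-qadv land package; see the module docstring). -/
theorem wtPrefix_step (u : Fin n → Bool) {k : ℕ} (hk : k < n) :
    wtPrefix u (k + 1) = wtPrefix u k + (u ⟨k, hk⟩).toNat := by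
  unfold wtPrefix
  have hs : (univ.filter fun i : Fin n => i.val < k + 1 ∧ u i = true) =
      (univ.filter fun i : Fin n => i.val < k ∧ u i = true) ∪
        (univ.filter fun i : Fin n => i = ⟨k, hk⟩ ∧ u i = true) := by
    ext i
    simp only [mem_filter, mem_univ, true_and, mem_union, Fin.ext_iff]
    constructor
    · rintro ⟨h1, h2⟩
      by_cases h3 : i.val < k
      · exact Or.inl ⟨h3, h2⟩
      · exact Or.inr ⟨by omega, h2⟩
    · rintro (⟨h1, h2⟩ | ⟨h1, h2⟩)
      · exact ⟨by omega, h2⟩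
      · exact ⟨by omega, h2⟩
  rw [hs, card_union_of_disjoint (disjoint_filter.2 fun i _ h1 h2 => by
    rw [Fin.ext_iff] at h2; simp only at h2; omega)]
  congr 1
  cases hu : u ⟨k, hk⟩
  · rw [Bool.toNat_false, card_eq_zero, filter_eq_empty_iff]
    rintro i - ⟨rfl, h⟩; rw [hu] at h; exact Bool.false_ne_true h
  · rw [Bool.toNat_true, card_eq_one]
    refine ⟨⟨k, hk⟩, ?_⟩
    ext i
    simp only [mem_filter, mem_univ, true_and, mem_singleton]
    exact ⟨fun h => h.1, fun h => ⟨h, by rw [h, hu]⟩⟩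


/-- CharDialWindowCounter helper `wtPrefix_mono'` (decomp-qadv land package; see the module docstring). -/
theorem wtPrefix_mono' (u : Fin n → Bool) {a b : ℕ} (hab : a ≤ b) : wtPrefix u a ≤ wtPrefix u b := by
  unfold wtPrefix
  exact card_le_card fun i hi => by
    simp only [mem_filter, mem_univ, true_and] at hi ⊢; exact ⟨by omega, hi.2⟩

/-- the register cell `k-1-i` holds bit `i`. -/
theorem getD_regAt (u : Fin n → Bool) (r : List Bool) :
    ∀ k (hk : k ≤ n) i (hi : i < k), (regAt u k r).getD (k - 1 - i) false = u ⟨i, by omega⟩ := by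
  intro k
  induction k with
  | zero => intro _ i hi; omega
  | succ k ih =>
    intro hk i hi
    rw [regAt_succ u (by omega : k < n)]
    by_cases hik : i = k
    · subst hik
      rw [show i + 1 - 1 - i = 0 by omega, List.getD_cons_zero]
    · rw [show k + 1 - 1 - i = (k - 1 - i) + 1 by omega, List.getD_cons_succ]
      exact ih (by omega) i (by omega)

/-- ones in the top `j` cells = the last `j` bits' weight. -/
theorem ones_take_regAt (u : Fin n → Bool) (r : List Bool) :
    ∀ j k, j ≤ k → k ≤ n → ones ((regAt u k r).take j) + wtPrefix u (k - j) = wtPrefix u k := by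
  intro j
  induction j with
  | zero => intro k _ _; simp
  | succ j ih =>
    intro k hjk hkn
    obtain ⟨k', rfl⟩ : ∃ k', k = k' + 1 := ⟨k - 1, by omega⟩
    rw [regAt_succ u (by omega : k' < n), List.take_succ_cons, ones_cons, Nat.succ_sub_succ,
      wtPrefix_step u (by omega : k' < n)]
    have := ih k' (by omega) (by omega)
    omega

variable (ℓ : ℕ) (y : Fin (n + 1) → (Fin n → Bool) → Bool) (c w : ℕ)

/-- the input as seen at time `k`: past bits from the register, the current bit, future bits unknown (`false`). -/
def recon (k : ℕ) (r : List Bool) (b : Bool) : Fin n → Bool :=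
  fun i => if i.val < k then r.getD (k - 1 - i.val) false else if i.val = k then b else false

/-- CharDialWindowCounter helper `recon_regAt` (decomp-qadv land package; see the module docstring). -/
theorem recon_regAt (u : Fin n → Bool) {k : ℕ} (hk : k < n) (i : Fin n) (hi : i.val ≤ k) :
    recon k (regAt u k []) (u ⟨k, hk⟩) i = u i := by
  unfold recon
  by_cases h : i.val < k
  · rw [if_pos h, getD_regAt u [] k hk.le i.val h]
  · have : i.val = k := by omega
    rw [if_neg h, if_pos this]; congr 1; exact Fin.ext this.symm

/-- CharDialWindowCounter helper `recon_regAt_end` (decomp-qadv land package; see the module docstring). -/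
theorem recon_regAt_end (u : Fin n → Bool) (i : Fin n) : recon n (regAt u n []) false i = u i := by
  unfold recon
  rw [if_pos i.isLt, getD_regAt u [] n le_rfl i.val i.isLt]

/-- the per-cut firing-with-nonzero-exponent bit of a strategy. -/
def fires (g : Fin (n + 1)) (u : Fin n → Bool) : Bool :=
  decide (y g u = true ∧ (c + g.val + walkExp u g.val) % 3 ≠ 0)

/-- the sign table of a window-`ℓ` strategy on the class `wt ≡ w (mod 3)`: cut `k+1-ℓ` is emitted at time `k`. -/
def Etab (k : ℕ) (r : List Bool) (b : Bool) (P : ℕ) : Bool :=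
  if h : ℓ ≤ k + 1 ∧ k < n then
    decide (y ⟨k + 1 - ℓ, by omega⟩ (recon k r b) = true ∧
      (c + (k + 1 - ℓ) + w + P + 2 * ones (r.take (ℓ - 1))) % 3 ≠ 0)
  else false

/-- the last `ℓ` cuts `g = n+1-ℓ+x`, `x < ℓ`, read off the final register. -/
def Eend (x : ℕ) (r : List Bool) (P : ℕ) : Bool :=
  if h : n + 1 - ℓ + x < n + 1 then
    decide (y ⟨n + 1 - ℓ + x, h⟩ (recon n r false) = true ∧
      (c + (n + 1 - ℓ + x) + w + P + 2 * ones (r.take (ℓ - 1 - x))) % 3 ≠ 0)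
  else false

/-- the final factor. -/
def ftab (r : List Bool) (P : ℕ) : ℂ := ∏ x ∈ range ℓ, sgn (Eend ℓ y c w x r P)

/-- CharDialWindowCounter helper `Etab_periodic` (decomp-qadv land package; see the module docstring). -/
theorem Etab_periodic (k : ℕ) (r : List Bool) (b : Bool) (P : ℕ) :
    Etab ℓ y c w k r b (P + 3) = Etab ℓ y c w k r b P := by
  unfold Etab
  split_ifs with h
  · rw [show (c + (k + 1 - ℓ) + w + (P + 3) + 2 * ones (r.take (ℓ - 1))) % 3 =
        (c + (k + 1 - ℓ) + w + P + 2 * ones (r.take (ℓ - 1))) % 3 by omega]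
  · rfl

/-- CharDialWindowCounter helper `ftab_periodic` (decomp-qadv land package; see the module docstring). -/
theorem ftab_periodic (r : List Bool) (P : ℕ) : ftab ℓ y c w r (P + 3) = ftab ℓ y c w r P := by
  unfold ftab
  refine prod_congr rfl fun x _ => ?_
  unfold Eend
  split_ifs with h
  · rw [show (c + (n + 1 - ℓ + x) + w + (P + 3) + 2 * ones (r.take (ℓ - 1 - x))) % 3 =
        (c + (n + 1 - ℓ + x) + w + P + 2 * ones (r.take (ℓ - 1 - x))) % 3 by omega]
  · rfl

/-- CharDialWindowCounter helper `norm_ftab` (decomp-qadv land package; see the module docstring). -/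
theorem norm_ftab (r : List Bool) (P : ℕ) : ‖ftab ℓ y c w r P‖ ≤ 1 := by
  unfold ftab; rw [norm_prod]; simp [norm_sgn]

/-- CharDialWindowCounter helper `recon_local` (decomp-qadv land package; see the module docstring). -/
theorem recon_local {W k : ℕ} (hW : 2 * ℓ ≤ W + 1) {r r' : List Bool} (h : r.take W = r'.take W) (b : Bool)
    (hk : ℓ ≤ k + 1) (i : Fin n) (h1 : k + 1 - ℓ ≤ i.val + ℓ) : recon k r b i = recon k r' b i := by
  unfold recon
  by_cases hik : i.val < k
  · rw [if_pos hik, if_pos hik]; exact getD_of_take_eq h (by omega) _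
  · rw [if_neg hik, if_neg hik]

/-- the sign table is `2ℓ`-local (any `W ≥ 2ℓ - 1` works). -/
theorem Etab_local (hy : WindowLocal ℓ y) {W : ℕ} (hW : 2 * ℓ ≤ W + 1) (k : ℕ) (ρ ρ' : List Bool) (b : Bool) (P : ℕ)
    (h : ρ.take W = ρ'.take W) : Etab ℓ y c w k ρ b P = Etab ℓ y c w k ρ' b P := by
  unfold Etab
  split_ifs with hk
  · have hrec : y ⟨k + 1 - ℓ, by omega⟩ (recon k ρ b) = y ⟨k + 1 - ℓ, by omega⟩ (recon k ρ' b) :=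
      hy _ _ _ fun i h1 _ => recon_local ℓ hW h b hk.1 i h1
    rw [hrec, take_mono (by omega : ℓ - 1 ≤ W) h]
  · rfl

/-- CharDialWindowCounter helper `ftab_local` (decomp-qadv land package; see the module docstring). -/
theorem ftab_local (hy : WindowLocal ℓ y) {W : ℕ} (hW : 2 * ℓ ≤ W + 1) (hℓn : ℓ ≤ n + 1) (ρ ρ' : List Bool) (P : ℕ)
    (h : ρ.take W = ρ'.take W) : ftab ℓ y c w ρ P = ftab ℓ y c w ρ' P := by
  unfold ftab
  refine prod_congr rfl fun x hx => ?_
  rw [mem_range] at hx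
  unfold Eend
  split_ifs with hg
  · have hrec : y ⟨n + 1 - ℓ + x, hg⟩ (recon n ρ false) = y ⟨n + 1 - ℓ + x, hg⟩ (recon n ρ' false) :=
      hy _ _ _ fun i h1 _ => recon_local ℓ hW h false (by omega) i (by simp only at h1 ⊢; omega)
    rw [hrec, take_mono (by omega : ℓ - 1 - x ≤ W) h]
  · rfl

/-- **termwise, bulk**: at time `k = ℓ-1+x` the table emits exactly the sign of cut `x`. -/
theorem Etab_path (hy : WindowLocal ℓ y) (hℓ : 1 ≤ ℓ) (u : Fin n → Bool) (hw : wt u % 3 = w % 3) (x : ℕ)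
    (hx : x < n + 1 - ℓ) :
    Etab ℓ y c w (ℓ - 1 + x) (regAt u (ℓ - 1 + x) []) (u ⟨ℓ - 1 + x, by omega⟩) (wtPrefix u (ℓ - 1 + x)) =
      fires y c ⟨x, by omega⟩ u := by
  unfold Etab fires
  rw [dif_pos ⟨by omega, by omega⟩]
  have hg : (⟨ℓ - 1 + x + 1 - ℓ, by omega⟩ : Fin (n + 1)) = ⟨x, by omega⟩ := Fin.ext (by simp only; omega)
  have hrec : y ⟨ℓ - 1 + x + 1 - ℓ, by omega⟩ (recon (ℓ - 1 + x) (regAt u (ℓ - 1 + x) []) (u ⟨ℓ - 1 + x, by omega⟩)) =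
      y ⟨x, by omega⟩ u := by
    rw [hg]
    exact hy _ _ _ fun i _ h2 => recon_regAt u _ i (by simp only at h2; omega)
  have hones := ones_take_regAt u [] (ℓ - 1) (ℓ - 1 + x) (by omega) (by omega)
  rw [show ℓ - 1 + x - (ℓ - 1) = x by omega] at hones
  have hmono := wtPrefix_mono' u (show x ≤ ℓ - 1 + x by omega)
  have e : (c + (ℓ - 1 + x + 1 - ℓ) + w + wtPrefix u (ℓ - 1 + x) + 2 * ones ((regAt u (ℓ - 1 + x) []).take (ℓ - 1))) % 3 =
      (c + x + walkExp u x) % 3 := by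
    unfold walkExp; omega
  rw [hrec, e]

/-- **termwise, tail**: the final factor emits the signs of the last `ℓ` cuts. -/
theorem Eend_path (hy : WindowLocal ℓ y) (hℓn : ℓ ≤ n) (u : Fin n → Bool) (hw : wt u % 3 = w % 3) (x : ℕ) (hx : x < ℓ) :
    Eend ℓ y c w x (regAt u n []) (wt u) = fires y c ⟨n + 1 - ℓ + x, by omega⟩ u := by
  unfold Eend fires
  rw [dif_pos (by omega)]
  have hrec : y ⟨n + 1 - ℓ + x, by omega⟩ (recon n (regAt u n []) false) = y ⟨n + 1 - ℓ + x, by omega⟩ u :=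
    hy _ _ _ fun i _ _ => recon_regAt_end u i
  have hones := ones_take_regAt u [] (ℓ - 1 - x) n (by omega) le_rfl
  rw [show n - (ℓ - 1 - x) = n + 1 - ℓ + x by omega, ConstBells.wtPrefix_self] at hones
  have e : (c + (n + 1 - ℓ + x) + w + wt u + 2 * ones ((regAt u n []).take (ℓ - 1 - x))) % 3 =
      (c + (n + 1 - ℓ + x) + walkExp u (n + 1 - ℓ + x)) % 3 := by
    unfold walkExp; omega
  rw [hrec, e]

/-- **sign splitting for window strategies**: on the class `wt u ≡ w (mod 3)` the full sign product of `y` is the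
`GG`-integrand of the tables `Etab`, `ftab`. -/
theorem sign_split_window (hy : WindowLocal ℓ y) (hℓ : 1 ≤ ℓ) (hℓn : ℓ ≤ n) (u : Fin n → Bool)
    (hw : wt u % 3 = w % 3) :
    ∏ g : Fin (n + 1), sgn (fires y c g u) =
      pathSgn (Etab ℓ y c w) 0 [] 0 u * ftab ℓ y c w (regAt u n []) (0 + wt u) := by
  -- both sides as range products
  let fN : ℕ → ℂ := fun g => if h : g < n + 1 then sgn (fires y c ⟨g, h⟩ u) else 1
  let eN : ℕ → ℂ := fun j => if h : j < n then sgn (Etab ℓ y c w j (regAt u j []) (u ⟨j, h⟩) (wtPrefix u j)) else 1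
  have hL : ∏ g : Fin (n + 1), sgn (fires y c g u) = ∏ g ∈ range (n + 1), fN g := by
    rw [← Fin.prod_univ_eq_prod_range]
    refine prod_congr rfl fun g _ => ?_
    simp only [fN, dif_pos g.isLt]
  have hP : pathSgn (Etab ℓ y c w) 0 [] 0 u = ∏ j ∈ range n, eN j := by
    unfold pathSgn
    rw [← Fin.prod_univ_eq_prod_range]
    refine prod_congr rfl fun j _ => ?_
    simp only [eN, dif_pos j.isLt, zero_add]
  rw [hL, hP, zero_add, show range (n + 1) = range ((n + 1 - ℓ) + ℓ) by rw [show n + 1 - ℓ + ℓ = n + 1 by omega],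
    prod_range_add, show range n = range ((ℓ - 1) + (n + 1 - ℓ)) by rw [show ℓ - 1 + (n + 1 - ℓ) = n by omega],
    prod_range_add]
  have h1 : ∏ x ∈ range (ℓ - 1), eN x = 1 := by
    refine prod_eq_one fun x hx => ?_
    rw [mem_range] at hx
    simp only [eN, dif_pos (show x < n by omega)]
    unfold Etab
    rw [dif_neg (by omega), sgn_false]
  rw [h1, one_mul]
  congr 1
  · refine prod_congr rfl fun x hx => ?_
    rw [mem_range] at hx
    simp only [fN, eN, dif_pos (show x < n + 1 by omega), dif_pos (show ℓ - 1 + x < n by omega)]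
    rw [Etab_path ℓ y c w hy hℓ u hw x hx]
  · unfold ftab
    refine prod_congr rfl fun x hx => ?_
    rw [mem_range] at hx
    simp only [fN, dif_pos (show n + 1 - ℓ + x < n + 1 by omega)]
    rw [Eend_path ℓ y c w hy hℓn u hw x hx]

end Interface

/-! ## §D characters, twists and the Fourier assembly -/

/-- `∏ sgn = (-1)^{#fires}`. -/
theorem prod_sgn_fires {n : ℕ} (y : Fin (n + 1) → (Fin n → Bool) → Bool) (c : ℕ) (u : Fin n → Bool) :
    ∏ g : Fin (n + 1), sgn (fires y c g u) =
      (-1) ^ (univ.filter fun g : Fin (n + 1) => y g u = true ∧ (c + g.val + walkExp u g.val) % 3 ≠ 0).card := by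
  have : ∀ g : Fin (n + 1), sgn (fires y c g u) =
      if (y g u = true ∧ (c + g.val + walkExp u g.val) % 3 ≠ 0) then (-1 : ℂ) else 1 := fun g => by
    unfold fires sgn; by_cases h : (y g u = true ∧ (c + g.val + walkExp u g.val) % 3 ≠ 0) <;> simp [h]
  simp only [this]
  rw [prod_ite, prod_const, prod_const_one, mul_one]

/-- the WIN indicator through the sign product. -/
theorem win_indicator {n : ℕ} (y : Fin (n + 1) → (Fin n → Bool) → Bool) (c : ℕ) (u : Fin n → Bool) :
    (if ringWinU c y u = true then (1 : ℂ) else 0) = (1 - ∏ g : Fin (n + 1), sgn (fires y c g u)) / 2 := by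
  rw [prod_sgn_fires]
  unfold ringWinU
  set k := (univ.filter fun g : Fin (n + 1) => y g u = true ∧ (c + g.val + walkExp u g.val) % 3 ≠ 0).card
  rcases Nat.even_or_odd k with hk | hk
  · rw [hk.neg_one_pow, if_neg (by simpa [Nat.even_iff] using hk)]; ring
  · rw [hk.neg_one_pow, if_pos (by simpa [Nat.odd_iff] using hk)]; ring

/-- the plain twisted sum is a `GG` (no signs, unit continuation). -/
theorem sum_pow_wt_eq_GG (n : ℕ) (μ : ℂ) :
    ∑ u : Fin n → Bool, μ ^ wt u = GG μ (fun _ _ _ _ => false) (fun _ _ _ => 1) n 0 [] 0 := by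
  unfold GG pathSgn; simp

section Chars

variable (N : ℕ) [NeZero N]

/-- indicator of `b = 0` through the standard additive character. -/
theorem ite_eq_sum_char (b : ZMod N) :
    (if b = 0 then (N : ℂ) else 0) = ∑ x : ZMod N, ZMod.stdAddChar (x * b) := by
  rw [AddChar.sum_mulShift b (ZMod.isPrimitive_stdAddChar N)]
  simp [ZMod.card, Nat.cast_ite]

/-- CharDialWindowCounter helper `char_natMul` (decomp-qadv land package; see the module docstring). -/
theorem char_natMul (m : ℕ) (t : ZMod N) : ZMod.stdAddChar ((m : ZMod N) * t) = (ZMod.stdAddChar t : ℂ) ^ m := by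
  rw [← nsmul_eq_mul, AddChar.map_nsmul_eq_pow]

/-- CharDialWindowCounter helper `char_ne_one` (decomp-qadv land package; see the module docstring). -/
theorem char_ne_one {x : ZMod N} (hx : x ≠ 0) : (ZMod.stdAddChar x : ℂ) ≠ 1 := fun h =>
  hx ((AddChar.IsPrimitive.zmod_char_eq_one_iff N (ZMod.isPrimitive_stdAddChar N) x).mp h)


end Chars

/-- `‖1 + z‖ < 2` for a unit complex number `z ≠ 1`. -/
theorem norm_one_add_lt_two {z : ℂ} (hz : ‖z‖ = 1) (hz1 : z ≠ 1) : ‖1 + z‖ < 2 := by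
  by_contra h
  push Not at h
  have h1 : z.re * z.re + z.im * z.im = 1 := by
    rw [← Complex.normSq_apply, Complex.normSq_eq_norm_sq, hz]; norm_num
  have h2 : ‖1 + z‖ ^ 2 = 2 + 2 * z.re := by
    rw [Complex.sq_norm, Complex.normSq_apply]; simp; nlinarith [h1]
  have h3 : (4 : ℝ) ≤ ‖1 + z‖ ^ 2 := by nlinarith [h, norm_nonneg (1 + z)]
  have hre : z.re = 1 := by nlinarith [h1, h2, h3, sq_nonneg z.im]
  have him : z.im = 0 := by nlinarith [h1, hre]
  exact hz1 (Complex.ext (by simp [hre]) (by simp [him]))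

section Main

variable (p : ℕ) [Fact p.Prime]


end Main
end Summit.QuantumAdvantage.AdviceFreeQNC0.WindowCounter
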